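import Literature.NumberTheory.QuadraticForms.HilbertReciprocityRat
import Literature.NumberTheory.QuadraticForms.HasseInvariantFrames
import HarnessLib

/-!
# Serre's local symbols of `ℚ` as Hasse symbols

Topic `NumberTheory/QuadraticForms`; namespace `Literature.NumberTheory.QuadraticForms`. Everything
here is proved.

For the invariance theorem of `HasseInvariantFrames.lean` we need, at every place `v` of `ℚ`, a
symbol `s_v : ℚ → ℚ → ℤ` with the four properties of `IsHasseSymbol` (symmetric, multiplicative,
`±1`-valued, equal on isomorphic binary forms). We take Serre's explicit local symbols
(*A Course in Arithmetic*, Ch. III §1.2 Thm. 1), already available on non-zero **integers** as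
`localSignInfty` and `localSign p` (`HilbertSymbolRatSigns.lean`, `HilbertReciprocityRat.lean`),
extended to rationals through the integer representative `a.num * a.den` of the square class of
`a` (`ratSign p`, `ratSignInfty`).

* `hilbertSymbol_binary`: over any field, `(a, b) = (a', b')` when `a' = a x² + b y²` and
  `a' b' = a b c²` — isomorphic binary forms `⟨a, b⟩ ≅ ⟨a', a a' b⟩ ≅ ⟨a', b'⟩` represent the same
  elements (Serre, Ch. IV §2.1, proof of Thm. 5, case `n = 2`).
* `isHasseSymbol_ratSign`: for a prime `p`, `ratSign p` is a Hasse symbol. Proof: by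
  `hilbertSymbol_rat_eq_localSign` (Serre III Thm. 1 for `ℚ`, proved in
  `HilbertReciprocityRat.lean`) it is the genuine Hilbert symbol of the completion `ℚ_v`, `v ∣ p`,
  which is `±1`-valued and satisfies the binary invariance; multiplicativity is transported from
  the integer statements `localSignTwo_mul_left` / `localSignOdd_mul_left`.
* `isHasseSymbol_ratSignInfty`: the sign at infinity, `-1` iff `a, b < 0`, directly.
* `ratSign_intCast`, `ratSignInfty_intCast`: on integers these are the explicit signs, so that the
  product formula `totalSign_eq_one` applies to Hasse products of integral frames.

## References

* J.-P. Serre, *A Course in Arithmetic*, GTM 7, Springer 1973, Ch. III §1.2 Thm. 1, §2.1 Thm. 3;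
  Ch. IV §2.1 Thm. 5 (PDF pp. 20–23, 33–34). [Serre1973]
-/

noncomputable section

namespace Literature.NumberTheory.QuadraticForms

open IsDedekindDomain NumberField Rat.HeightOneSpectrum

/-! ### Binary invariance of the Hilbert symbol over any field -/

/-- **Isomorphic binary forms have the same Hilbert symbol.** Over any field `F`: if
`a' = a x² + b y² ≠ 0` and `a' b' = a b c²` with `a b b' c ≠ 0`, then `(a, b)_F = (a', b')_F`.
Indeed `⟨a, b⟩ ≅ ⟨a', a b a'⟩` by the change of variables `X = x X' - b y Y'`,
`Y = y X' + a x Y'` (of determinant `a'`), `⟨a', a b a'⟩ ≅ ⟨a', b'⟩` (`b' = a b a' (c/a')²`), and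
`(u, w)_F = 1` iff `⟨u, w⟩` represents `1` (Serre, Ch. IV §2.1, proof of Thm. 5 for `n = 2`:
"`ε(e) = 1` iff `a₁X² + a₂Y²` represents `1`, and this does not depend on `e`").
[cite: Serre1973, Ch. IV §2.1 Thm. 5] -/
theorem hilbertSymbol_binary {F : Type*} [Field F] {a b a' b' x y c : F}
    (ha' : a' ≠ 0) (hc : c ≠ 0) (h1 : a' = a * x ^ 2 + b * y ^ 2)
    (h2 : a' * b' = a * b * c ^ 2) : hilbertSymbol F a b = hilbertSymbol F a' b' := by
  -- `⟨a', b'⟩ = ⟨a', (a b a') (c / a')²⟩`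
  have hb'eq : b' = a * b * a' * (c / a') ^ 2 := by
    field_simp
    linear_combination h2
  rw [hb'eq, hilbertSymbol_mul_sq_right _ _ (div_ne_zero hc ha')]
  -- `⟨a, b⟩` and `⟨a', a b a'⟩` represent the same elements
  have key : (∃ X Y : F, a * X ^ 2 + b * Y ^ 2 = 1) ↔
      ∃ X' Y' : F, a' * X' ^ 2 + a * b * a' * Y' ^ 2 = 1 := by
    constructor
    · rintro ⟨X, Y, hXY⟩
      refine ⟨(a * x * X + b * y * Y) / a', (-y * X + x * Y) / a', ?_⟩
      rw [← hXY]
      field_simp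
      rw [h1]
      ring
    · rintro ⟨X', Y', hXY⟩
      refine ⟨x * X' - b * y * Y', y * X' + a * x * Y', ?_⟩
      rw [← hXY, h1]
      ring
  exact eq_of_sign_of_iff (hilbertSymbol_eq_one_or_eq_neg_one a b)
    (hilbertSymbol_eq_one_or_eq_neg_one _ _)
    ((hilbertSymbol_eq_one_iff a b).trans (key.trans (hilbertSymbol_eq_one_iff _ _).symm))

/-! ### The rational symbols -/

/-- Serre's explicit local symbol `(a, b)_p` of two **rationals** at a prime `p`, computed on the
integer representatives `a.num * a.den ≡ a (mod ℚˣ²)`: `localSign p` of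
`HilbertReciprocityRat.lean` (Serre, Ch. III §1.2 Thm. 1). [cite: Serre1973, Ch. III §1.2 Thm. 1] -/
def ratSign (p : ℕ) (a b : ℚ) : ℤ := localSign p (a.num * a.den) (b.num * b.den)

/-- The sign at infinity of two rationals: `(a, b)_∞ = -1` iff `a, b < 0`
(Serre, Ch. III §1.2 Thm. 1, `k = ℝ`). [cite: Serre1973, Ch. III §1.2 Thm. 1] -/
def ratSignInfty (a b : ℚ) : ℤ := if a < 0 ∧ b < 0 then -1 else 1

/-- On integers, `ratSign p` is the explicit integer sign `localSign p`. [folklore] -/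
@[simp] theorem ratSign_intCast (p : ℕ) (a b : ℤ) : ratSign p a b = localSign p a b := by
  simp [ratSign]

/-- On integers, `ratSignInfty` is `localSignInfty`. [folklore] -/
@[simp] theorem ratSignInfty_intCast (a b : ℤ) : ratSignInfty a b = localSignInfty a b := by
  simp [ratSignInfty, localSignInfty, Int.cast_lt_zero]

/-- The integer representative `a.num * a.den` of a non-zero rational is non-zero. [folklore] -/
theorem num_mul_den_ne_zero {a : ℚ} (ha : a ≠ 0) : a.num * (a.den : ℤ) ≠ 0 :=
  mul_ne_zero (Rat.num_ne_zero.mpr ha) (Int.natCast_ne_zero.mpr a.den_nz)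

/-- In `ℚ`, `a.num * a.den = a * a.den²`. [folklore] -/
theorem cast_num_mul_den (a : ℚ) : ((a.num * (a.den : ℤ) : ℤ) : ℚ) = a * (a.den : ℚ) ^ 2 := by
  push_cast
  rw [← Rat.mul_den_eq_num, sq, mul_assoc]

/-- **`ratSign p` is the Hilbert symbol of the completion.** For a finite place `v` of `ℚ` over
`p` and non-zero rationals `a b`: `ratSign p a b = (a, b)_{ℚ_v}` (Serre III Thm. 1 for `ℚ`, via
`hilbertSymbol_rat_eq_localSign` on the integer representatives and square-class invariance of the
Hilbert symbol). [cite: Serre1973, Ch. III §1.2 Thm. 1] -/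
theorem ratSign_eq_hilbertSymbol (v : HeightOneSpectrum (𝓞 ℚ)) {a b : ℚ} (ha : a ≠ 0) (hb : b ≠ 0) :
    ratSign (natGenerator v) a b =
      hilbertSymbol (v.adicCompletion ℚ) (algebraMap ℚ _ a) (algebraMap ℚ _ b) := by
  unfold ratSign
  rw [← hilbertSymbol_rat_eq_localSign v (num_mul_den_ne_zero ha) (num_mul_den_ne_zero hb),
    cast_num_mul_den, cast_num_mul_den, map_mul, map_mul, map_pow, map_pow,
    hilbertSymbol_mul_sq_left _ _
      ((map_ne_zero_iff _ (algebraMap ℚ _).injective).mpr (Nat.cast_ne_zero.mpr a.den_nz)),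
    hilbertSymbol_mul_sq_right _ _
      ((map_ne_zero_iff _ (algebraMap ℚ _).injective).mpr (Nat.cast_ne_zero.mpr b.den_nz))]

/-- `localSign p` is symmetric. [folklore] -/
theorem localSign_comm (p : ℕ) (a b : ℤ) : localSign p a b = localSign p b a := by
  unfold localSign
  split_ifs with h
  · exact localSignTwo_comm a b
  · by_cases hp : p.Prime
    · haveI := Fact.mk hp
      exact localSignOdd_comm a b
    · simp [localSignOdd, hp]

/-- `localSign p` is multiplicative in the first variable on non-zero integers. [folklore] -/
theorem localSign_mul_left (p : ℕ) {a a' b : ℤ} (ha : a ≠ 0) (ha' : a' ≠ 0) (hb : b ≠ 0) :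
    localSign p (a * a') b = localSign p a b * localSign p a' b := by
  unfold localSign
  split_ifs with h
  · exact localSignTwo_mul_left ha ha' hb
  · by_cases hp : p.Prime
    · haveI := Fact.mk hp
      exact localSignOdd_mul_left ha ha' b
    · simp [localSignOdd, hp]

variable {p : ℕ} [hp : Fact p.Prime]

/-- A finite place of `ℚ` over the prime `p`. [folklore] -/
theorem exists_place_natGenerator_eq (p : ℕ) [hp : Fact p.Prime] :
    ∃ v : HeightOneSpectrum (𝓞 ℚ), natGenerator v = p :=
  ⟨(primesEquiv (R := 𝓞 ℚ)).symm ⟨p, hp.out⟩,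
    congrArg Subtype.val ((primesEquiv (R := 𝓞 ℚ)).apply_symm_apply ⟨p, hp.out⟩)⟩

/-- `ratSign p` of non-zero rationals is `±1` (it is a Hilbert symbol). [folklore] -/
theorem ratSign_eq_one_or (p : ℕ) [Fact p.Prime] {a b : ℚ} (ha : a ≠ 0) (hb : b ≠ 0) :
    ratSign p a b = 1 ∨ ratSign p a b = -1 := by
  obtain ⟨v, hv⟩ := exists_place_natGenerator_eq p
  rw [← hv, ratSign_eq_hilbertSymbol v ha hb]
  exact hilbertSymbol_eq_one_or_eq_neg_one _ _

/-- `localSign p` of non-zero integers is `±1`. [folklore] -/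
theorem localSign_eq_one_or (p : ℕ) [Fact p.Prime] {a b : ℤ} (ha : a ≠ 0) (hb : b ≠ 0) :
    localSign p a b = 1 ∨ localSign p a b = -1 := by
  have h := ratSign_eq_one_or p (a := a) (b := b) (by exact_mod_cast ha) (by exact_mod_cast hb)
  rwa [ratSign_intCast] at h

/-- Square-class invariance of `localSign p` in the first variable. [folklore] -/
theorem localSign_mul_sq_left (p : ℕ) [Fact p.Prime] {a b c : ℤ} (ha : a ≠ 0) (hb : b ≠ 0)
    (hc : c ≠ 0) : localSign p (a * c ^ 2) b = localSign p a b := by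
  rw [sq, localSign_mul_left p ha (mul_ne_zero hc hc) hb, localSign_mul_left p hc hc hb]
  rcases localSign_eq_one_or p hc hb with h | h <;> rw [h] <;> norm_num

/-- **`ratSign p` is a Hasse symbol on `ℚ`** (`p` prime): symmetric, multiplicative, `±1`-valued
and equal on isomorphic binary forms — the properties of the Hilbert symbol `(a, b)_p` used in
Serre's proof that `εₚ = ∏_{i<j} (aᵢ, aⱼ)_p` is an invariant (Ch. IV §2.1 Thm. 5), here for the
explicit symbol of Ch. III §1.2 Thm. 1. [cite: Serre1973, Ch. IV §2.1 Thm. 5] -/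
theorem isHasseSymbol_ratSign (p : ℕ) [Fact p.Prime] : IsHasseSymbol (ratSign p) where
  comm a b := by unfold ratSign; exact localSign_comm p _ _
  mul_left a a' b ha ha' hb := by
    unfold ratSign
    rw [← localSign_mul_left p (num_mul_den_ne_zero ha) (num_mul_den_ne_zero ha')
      (num_mul_den_ne_zero hb)]
    -- both integer representatives of `a a'` differ by square factors
    set B := b.num * (b.den : ℤ)
    have hB : B ≠ 0 := num_mul_den_ne_zero hb
    have hx : (a * a').num * ((a * a').den : ℤ) ≠ 0 := num_mul_den_ne_zero (mul_ne_zero ha ha')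
    have hy : a.num * (a.den : ℤ) * (a'.num * (a'.den : ℤ)) ≠ 0 :=
      mul_ne_zero (num_mul_den_ne_zero ha) (num_mul_den_ne_zero ha')
    have hd₁ : ((a * a').den : ℤ) ≠ 0 := Int.natCast_ne_zero.mpr (a * a').den_nz
    have hd₂ : (a.den : ℤ) * (a'.den : ℤ) ≠ 0 :=
      mul_ne_zero (Int.natCast_ne_zero.mpr a.den_nz) (Int.natCast_ne_zero.mpr a'.den_nz)
    have hrel : (a * a').num * ((a * a').den : ℤ) * ((a.den : ℤ) * (a'.den : ℤ)) ^ 2 =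
        a.num * (a.den : ℤ) * (a'.num * (a'.den : ℤ)) * ((a * a').den : ℤ) ^ 2 := by
      have h : (((a * a').num * ((a * a').den : ℤ) * ((a.den : ℤ) * (a'.den : ℤ)) ^ 2 : ℤ) : ℚ) =
          ((a.num * (a.den : ℤ) * (a'.num * (a'.den : ℤ)) * ((a * a').den : ℤ) ^ 2 : ℤ) : ℚ) := by
        push_cast
        rw [← Rat.mul_den_eq_num (a * a'), ← Rat.mul_den_eq_num a, ← Rat.mul_den_eq_num a']
        ring
      exact_mod_cast h
    rw [← localSign_mul_sq_left p hx hB hd₂, hrel, localSign_mul_sq_left p hy hB hd₁]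
  mul_self a b ha hb := by
    rcases ratSign_eq_one_or p ha hb with h | h <;> rw [h] <;> norm_num
  binary a b a' b' x y c ha hb ha' hb' hc h1 h2 := by
    obtain ⟨v, hv⟩ := exists_place_natGenerator_eq p
    rw [← hv, ratSign_eq_hilbertSymbol v ha hb, ratSign_eq_hilbertSymbol v ha' hb']
    have hinj : Function.Injective (algebraMap ℚ (v.adicCompletion ℚ)) := (algebraMap ℚ _).injective
    refine hilbertSymbol_binary (x := algebraMap ℚ _ x) (y := algebraMap ℚ _ y)
      (c := algebraMap ℚ _ c) ?_ ?_ ?_ ?_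
    · exact (map_ne_zero_iff _ hinj).mpr ha'
    · exact (map_ne_zero_iff _ hinj).mpr hc
    · rw [h1]; simp only [map_add, map_mul, map_pow]
    · rw [← map_mul, h2]; simp only [map_mul, map_pow]

omit hp in
/-- **The sign at infinity is a Hasse symbol on `ℚ`**: `(a, b)_∞ = -1` iff `a, b < 0`; the binary
invariance is the rule of signs (`a' = a x² + b y²`, `a' b' = a b c²`). [cite: Serre1973, Ch. III §1.2 Thm. 1] -/
theorem isHasseSymbol_ratSignInfty : IsHasseSymbol ratSignInfty where
  comm a b := by unfold ratSignInfty; simp only [and_comm]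
  mul_left a a' b ha ha' hb := by
    unfold ratSignInfty
    by_cases h3 : b < 0
    · rcases lt_or_gt_of_ne ha with h1 | h1 <;> rcases lt_or_gt_of_ne ha' with h2 | h2
      · have h12 : ¬ a * a' < 0 := not_lt.2 (mul_pos_of_neg_of_neg h1 h2).le
        simp [h1, h2, h3, h12]
      · have h12 : a * a' < 0 := mul_neg_of_neg_of_pos h1 h2
        have h2' : ¬ a' < 0 := not_lt.2 h2.le
        simp [h1, h3, h12, h2']
      · have h12 : a * a' < 0 := mul_neg_of_pos_of_neg h1 h2
        have h1' : ¬ a < 0 := not_lt.2 h1.le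
        simp [h2, h3, h12, h1']
      · have h12 : ¬ a * a' < 0 := not_lt.2 (mul_pos h1 h2).le
        have h1' : ¬ a < 0 := not_lt.2 h1.le
        have h2' : ¬ a' < 0 := not_lt.2 h2.le
        simp [h3, h12, h1', h2']
    · simp [h3]
  mul_self a b ha hb := by
    unfold ratSignInfty
    split_ifs <;> norm_num
  binary a b a' b' x y c ha hb ha' hb' hc h1 h2 := by
    unfold ratSignInfty
    have hc2 : 0 < c ^ 2 := by positivity
    have key : (a < 0 ∧ b < 0) ↔ (a' < 0 ∧ b' < 0) := by
      constructor
      · rintro ⟨h3, h4⟩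
        have h5 : a' ≤ 0 := by
          rw [h1]
          nlinarith [sq_nonneg x, sq_nonneg y]
        have h6 : a' < 0 := lt_of_le_of_ne h5 ha'
        refine ⟨h6, ?_⟩
        have h7 : 0 < a' * b' := by rw [h2]; exact mul_pos (mul_pos_of_neg_of_neg h3 h4) hc2
        nlinarith
      · rintro ⟨h3, h4⟩
        have h7 : 0 < a * b := by
          have : 0 < a * b * c ^ 2 := by rw [← h2]; exact mul_pos_of_neg_of_neg h3 h4
          exact pos_of_mul_pos_left this hc2.le |> fun h => by nlinarith [this]
        rcases lt_or_gt_of_ne ha with h8 | h8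
        · exact ⟨h8, by nlinarith⟩
        · exfalso
          have h9 : 0 < b := by nlinarith
          have : 0 ≤ a' := by rw [h1]; nlinarith [sq_nonneg x, sq_nonneg y]
          linarith
    by_cases h : a < 0 ∧ b < 0
    · rw [if_pos h, if_pos (key.mp h)]
    · rw [if_neg h, if_neg (fun h' => h (key.mpr h'))]

end Literature.NumberTheory.QuadraticForms
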